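import Mathlib
import Summits.Ventures.PercRepro2.Tail2DBlockCalc
import Summits.Ventures.PercRepro2.Tail2DHarrisSP
import Summits.Ventures.PercRepro2.Tail2DFlowOneBlocks
import Summits.Ventures.PercRepro2.Tail2DSDomSwap
import Summits.Ventures.PercRepro2.Tail2DFlowOneStep01
import Summits.Ventures.PercRepro2.Tail2DFlowOneAxis

/-!
# The axes of (SD) on the class closed under series composition and parallel composition with a flow-one factor
(seat mine-b, cell pub-perc-repro2; conjectures/MINE-B.md §43)

`Tail2DFlowOneAxis.lean` proves (SD) on both axes along a comb of flow-one factors.  The two ingredients — (SD) on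
the blue axis and the log-concavity of the blue-axis tails (`AxisLC`) — are also preserved by SERIES composition
(tails multiply: `sdomZ_ser`, `axisLC_ser`) and by parallel composition with a flow-one factor on EITHER side (the
two factors of a parallel composition can be exchanged: `sdomZ_par_comm`, through the order isomorphism
`Prod.swap` of the configuration types).  Hence the **class `AxisComb`** — the absent edge and the flow-one networks
with a red crossing (every free edge among them) as atoms, closed under `ser` and under `par` with a flow-one factor
on either side; it contains every leaf-parallel pattern of the lane and every series–parallel term all of whose
parallel nodes have a bridge-containing side — carries (SD) at every blue-axis position `(0,c)` and every red-axis
position `(c+1, −1)` (`sdomZ_axisComb_blue`, `sdomZ_axisComb_red`, `sdomZ_axisComb_axis`).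
-/

namespace Summit.Ventures.PercRepro2.Tail2D

open V2Closure Finset

/-- the class: the absent edge, flow-one networks with a red crossing, series compositions, and parallel
compositions with a flow-one factor (with a red crossing) on either side -/
inductive AxisComb : V2Closure.SP → Prop
  | absent : AxisComb V2Closure.SP.absent
  | flowOne {s : V2Closure.SP} : FlowOneR s → AxisComb s
  | ser {s t : V2Closure.SP} : AxisComb s → AxisComb t → AxisComb (V2Closure.SP.ser s t)
  | parR {Y X : V2Closure.SP} : AxisComb Y → FlowOneR X → AxisComb (V2Closure.SP.par Y X)
  | parL {X Y : V2Closure.SP} : FlowOneR X → AxisComb Y → AxisComb (V2Closure.SP.par X Y)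

section Comm

variable (s t : V2Closure.SP)

/-- the exchange of the two factors of a parallel composition, on configurations -/
def swapPar : (V2Closure.SP.par s t).Conf → (V2Closure.SP.par t s).Conf := fun p => (p.2, p.1)

/-- the exchange is an involution -/
theorem swapPar_swapPar (p : (V2Closure.SP.par s t).Conf) : swapPar t s (swapPar s t p) = p := rfl

/-- the exchange is injective -/
theorem swapPar_injective : Function.Injective (swapPar s t) := by
  intro p q h
  have := congrArg (swapPar t s) h
  rwa [swapPar_swapPar, swapPar_swapPar] at this

/-- the exchange preserves the configuration order -/
theorem swapPar_le_iff (p q : (V2Closure.SP.par s t).Conf) : swapPar s t p ≤ swapPar s t q ↔ p ≤ q := by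
  show (p.2 ≤ q.2 ∧ p.1 ≤ q.1) ↔ (p.1 ≤ q.1 ∧ p.2 ≤ q.2)
  exact and_comm

/-- the exchange swaps the red flows of the factors (the sum is unchanged) -/
theorem rLab_swapPar (p : (V2Closure.SP.par s t).Conf) :
    (V2Closure.SP.par t s).rLab (swapPar s t p) = (V2Closure.SP.par s t).rLab p := by
  show t.rLab p.2 + s.rLab p.1 = s.rLab p.1 + t.rLab p.2
  exact add_comm _ _

/-- the exchange swaps the blue flows of the factors (the sum is unchanged) -/
theorem bLab_swapPar (p : (V2Closure.SP.par s t).Conf) :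
    (V2Closure.SP.par t s).bLab (swapPar s t p) = (V2Closure.SP.par s t).bLab p := by
  show t.bLab p.2 + s.bLab p.1 = s.bLab p.1 + t.bLab p.2
  exact add_comm _ _

/-- membership in the image of a block under the exchange -/
theorem mem_image_swapPar (A : Finset (V2Closure.SP.par s t).Conf) (q : (V2Closure.SP.par t s).Conf) :
    q ∈ A.image (swapPar s t) ↔ swapPar t s q ∈ A := by
  rw [Finset.mem_image]
  constructor
  · rintro ⟨p, hp, rfl⟩
    rwa [swapPar_swapPar]
  · intro hq
    exact ⟨swapPar t s q, hq, swapPar_swapPar t s q⟩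

/-- **a block domination is carried over the exchange of the factors** -/
theorem blockDom_par_comm {A A' : Finset (V2Closure.SP.par s t).Conf} (h : BlockDom (V2Closure.SP.par s t) A A') :
    BlockDom (V2Closure.SP.par t s) (A.image (swapPar s t)) (A'.image (swapPar s t)) := by
  intro f hf
  unfold blockSum
  rw [Finset.sum_image (fun x _ y _ h => swapPar_injective s t h),
    Finset.sum_image (fun x _ y _ h => swapPar_injective s t h),
    Finset.card_image_of_injective _ (swapPar_injective s t),
    Finset.card_image_of_injective _ (swapPar_injective s t)]
  have hmono : Monotone (fun p : (V2Closure.SP.par s t).Conf => f (swapPar s t p)) := by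
    intro p q hpq
    exact hf ((swapPar_le_iff s t p q).2 hpq)
  exact h _ hmono

/-- the exchange maps tails onto tails -/
theorem image_swapPar_tailSet (a c : ℕ) :
    (tailSet (V2Closure.SP.par s t) a c).image (swapPar s t) = tailSet (V2Closure.SP.par t s) a c := by
  ext q
  rw [mem_image_swapPar, mem_tailSet_iff, mem_tailSet_iff]
  have h1 := rLab_swapPar t s q
  have h2 := bLab_swapPar t s q
  rw [h1, h2]

/-- **(SD) is symmetric in the two factors of a parallel composition** -/
theorem sdomZ_par_comm (u v : ℤ) (h : SDomZ (V2Closure.SP.par s t) u v) : SDomZ (V2Closure.SP.par t s) u v := by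
  rw [sdomZ_iff_blockDom] at h ⊢
  have := blockDom_par_comm s t h
  rwa [image_swapPar_tailSet, image_swapPar_tailSet] at this

/-- the tails of a parallel composition are symmetric in the factors -/
theorem tailCount_par_comm (a c : ℕ) :
    tailCount (V2Closure.SP.par t s) a c = tailCount (V2Closure.SP.par s t) a c := by
  rw [tailCount_eq_card, tailCount_eq_card, ← image_swapPar_tailSet,
    Finset.card_image_of_injective _ (swapPar_injective s t)]

/-- the blue-axis log-concavity is symmetric in the factors -/
theorem axisLC_par_comm (h : AxisLC (V2Closure.SP.par s t)) : AxisLC (V2Closure.SP.par t s) := by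
  intro c hc
  rw [tailCount_par_comm s t, tailCount_par_comm s t, tailCount_par_comm s t]
  exact h c hc

end Comm

section Series

variable (s t : V2Closure.SP)

/-- the blue-axis log-concavity is preserved by series composition (a product of log-concave sequences) -/
theorem axisLC_ser (hs : AxisLC s) (ht : AxisLC t) : AxisLC (V2Closure.SP.ser s t) := by
  intro c hc
  rw [tailCount_ser, tailCount_ser, tailCount_ser]
  have h1 := hs c hc; have h2 := ht c hc
  calc tailCount s 0 (c - 1) * tailCount t 0 (c - 1) * (tailCount s 0 (c + 1) * tailCount t 0 (c + 1))
      = (tailCount s 0 (c - 1) * tailCount s 0 (c + 1)) * (tailCount t 0 (c - 1) * tailCount t 0 (c + 1)) := by ring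
    _ ≤ (tailCount s 0 c * tailCount s 0 c) * (tailCount t 0 c * tailCount t 0 c) := Nat.mul_le_mul h1 h2
    _ = tailCount s 0 c * tailCount t 0 c * (tailCount s 0 c * tailCount t 0 c) := by ring

end Series

section Atoms

/-- the absent edge has one configuration with labels `(0,0)`: `T(0,c) = 0` for `c ≥ 1` -/
theorem tailCount_absent_pos (c : ℕ) (hc : 1 ≤ c) : tailCount V2Closure.SP.absent 0 c = 0 := by
  rw [tailCount_eq_card, Finset.card_eq_zero, Finset.eq_empty_iff_forall_notMem]
  intro x hx
  rw [mem_tailSet_iff] at hx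
  have : V2Closure.SP.absent.bLab x = 0 := rfl
  omega

/-- the blue axis of the absent edge is log-concave -/
theorem axisLC_absent : AxisLC V2Closure.SP.absent := by
  intro c hc
  rw [tailCount_absent_pos (c + 1) (by omega)]
  simp

/-- (SD) on the blue axis of the absent edge -/
theorem sdomZ_absent_blue (c : ℕ) : SDomZ V2Closure.SP.absent 0 c := by
  rcases Nat.eq_zero_or_pos c with hc | hc
  · subst hc; exact sdomZ_of_le_one _ 0 0 (by norm_num) le_rfl
  · apply sdomZ_of_empty_tail
    right
    have e : ((c : ℤ) + 1).toNat = c + 1 := by omega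
    rw [e]
    exact tailCount_absent_pos (c + 1) (by omega)

end Atoms

section Main

/-- the blue axis of every member of the class is log-concave -/
theorem axisLC_axisComb : ∀ {Y : V2Closure.SP}, AxisComb Y → AxisLC Y
  | _, .absent => axisLC_absent
  | _, .flowOne hs => axisLC_flowOne _ hs.1
  | _, .ser hs ht => axisLC_ser _ _ (axisLC_axisComb hs) (axisLC_axisComb ht)
  | _, .parR hY hX => axisLC_par_flowOne _ _ hX.1 (axisLC_axisComb hY)
  | _, .parL hX hY => axisLC_par_comm _ _ (axisLC_par_flowOne _ _ hX.1 (axisLC_axisComb hY))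

/-- **(SD) at every blue-axis position `(0,c)` on every member of the class** -/
theorem sdomZ_axisComb_blue : ∀ {Y : V2Closure.SP}, AxisComb Y → ∀ c : ℕ, SDomZ Y 0 c
  | _, .absent, c => sdomZ_absent_blue c
  | _, .flowOne hs, c => sdomZ_flowOne_blue _ hs.1 c
  | _, .ser hs ht, c => sdomZ_ser _ _ 0 c (sdomZ_axisComb_blue hs c) (sdomZ_axisComb_blue ht c)
  | _, .parR hY hX, c => by
      rcases Nat.eq_zero_or_pos c with hc | hc
      · subst hc; exact sdomZ_of_le_one _ 0 0 (by norm_num) le_rfl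
      · have h0 : SDomZ _ 0 ((c : ℤ) - 1) :=
          sdomZ_clip_congr _ (u' := 0) (v' := ((c - 1 : ℕ) : ℤ)) (by omega) (by omega) (by omega) (by omega)
            (sdomZ_axisComb_blue hY (c - 1))
        exact sdomZ_par_flowOne_0c _ _ hX.1 hX.2 c hc (sdomZ_axisComb_blue hY c) h0 (axisLC_axisComb hY c hc)
  | _, .parL hX hY, c => by
      apply sdomZ_par_comm
      rcases Nat.eq_zero_or_pos c with hc | hc
      · subst hc; exact sdomZ_of_le_one _ 0 0 (by norm_num) le_rfl
      · have h0 : SDomZ _ 0 ((c : ℤ) - 1) :=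
          sdomZ_clip_congr _ (u' := 0) (v' := ((c - 1 : ℕ) : ℤ)) (by omega) (by omega) (by omega) (by omega)
            (sdomZ_axisComb_blue hY (c - 1))
        exact sdomZ_par_flowOne_0c _ _ hX.1 hX.2 c hc (sdomZ_axisComb_blue hY c) h0 (axisLC_axisComb hY c hc)

/-- **(SD) at every red-axis position `(c+1, −1)` on every member of the class** (the colour-swap duality) -/
theorem sdomZ_axisComb_red {Y : V2Closure.SP} (hY : AxisComb Y) (c : ℕ) : SDomZ Y (c + 1) (-1) := by
  have h := sdomZ_swap Y (sdomZ_axisComb_blue hY c)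
  norm_num at h
  exact h

/-- the axis members of (SD) on the class, at every clipped position with `u ≤ 0` or `v ≤ −1` -/
theorem sdomZ_axisComb_axis {Y : V2Closure.SP} (hY : AxisComb Y) (u v : ℤ) (h : u ≤ 0 ∨ v ≤ -1) : SDomZ Y u v := by
  rcases h with hu | hv
  · rcases (show v ≤ -1 ∨ 0 ≤ v by omega) with hv | hv
    · exact sdomZ_of_le_one Y u v (by omega) (by omega)
    · exact sdomZ_clip_congr Y (u' := 0) (v' := v.toNat) (by omega) (by omega) (by omega) (by omega)
        (sdomZ_axisComb_blue hY v.toNat)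
  · rcases (show u ≤ 1 ∨ 2 ≤ u by omega) with hu | hu
    · exact sdomZ_of_le_one Y u v hu (by omega)
    · exact sdomZ_clip_congr Y (u' := ((u - 1).toNat : ℤ) + 1) (v' := -1) (by omega) (by omega) (by omega) (by omega)
        (sdomZ_axisComb_red hY (u - 1).toNat)

/-- a free edge is a flow-one network with a red crossing, so every leaf-parallel-type term built from free edges,
absent edges, series compositions and parallel compositions with a free edge is in the class -/
theorem flowOneR_free : FlowOneR V2Closure.SP.free := by
  refine ⟨fun x => by cases x <;> simp [SP.rLab, SP.bLab], ?_⟩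
  exact Finset.card_pos.2 ⟨false, (mem_rSet _ _).2 (by simp [SP.rLab])⟩

/-- every leaf-parallel pattern of the lane is in the class -/
theorem axisComb_of_leafPar : ∀ {s : V2Closure.SP}, LeafPar s → AxisComb s
  | _, .free => .flowOne flowOneR_free
  | _, .absent => .absent
  | _, .ser hs ht => .ser (axisComb_of_leafPar hs) (axisComb_of_leafPar ht)
  | _, .parFree hs => .parR (axisComb_of_leafPar hs) flowOneR_free
  | _, .freePar hs => .parL flowOneR_free (axisComb_of_leafPar hs)

end Main

end Summit.Ventures.PercRepro2.Tail2D
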